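/-
Copyright (c) 2026 the pub-hodgecm-mathlib formalisation cell (harness21).  Prover seat hodgecm-mathlib-K2Liu-p01 (g8), Track B «K2-LIT»,
#184♮ = hLiu418 = `stmt-HodgeConjecture-24832`; #42S organ S1 ROAD W, F7 `K2LiuLocalSWParityOscillation` (RULINGS «M-158a» (2), «M-158b»; LEAD BATCH #8 (4): p01 keeps (ii));
SPEC-F7-FrameStep (ab42186030930277) §2 (ii), algebraic half: the HYPERBOLIC PAIR `(u, u′)` ⊥ `ℓ` in a diagonal ternary hermitian space from ONE isotropic norm equation
`d_i·N(λ) + d_j = 0` and ONE trace-one element `t₀ + σ t₀ = 1` (dyadic-safe; field algebra only).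
-/
import Mathlib.Algebra.BigOperators.Pi
import Mathlib.Algebra.Group.Pi.Lemmas
import Mathlib.FieldTheory.Finite.Basic
import HarnessLib

/-!
# Crux `HLiu418`, #42S-S1 ROAD W, file (T3-frame-ii-a): A HYPERBOLIC PAIR IN A DIAGONAL HERMITIAN SPACE FROM AN ISOTROPIC NORM EQUATION
# (`u = λe_i + e_j`, `u′ = d_j⁻¹e_j − (d_j⁻¹t₀)·u`: `h(u,u) = h(u′,u′) = 0`, `h(u,u′) = 1`, both ⊥ every `e_k`, `k ∉ {i,j}`)

Cell `hodgecm-mathlib`, crux item hLiu418 = `stmt-HodgeConjecture-24832` (helper lane `--supports … --as helper`, count-neutral).  THEOREMS ONLY (no `def`, no instance,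
no notation, no named-fact hypothesis, no `sorry`).  PURE FIELD ALGEBRA: `K` a field with a ring involution `σ` (model `E_w`), a diagonal hermitian form
`h(x, y) = Σ_k d_k · x_k · σ(y_k)` with `σ`-fixed non-zero `d_k` (model: `V′_w = V^ε_w` with its frame `dV′`, the `V′`-Gram of ★ (T3a) `gram_diagonal`).

WHY (DESIGN-W3-v2 §1, SPEC-F7-FrameStep §2 (ii)).  The inert count ★ F7c-B ∕ ★ (T3-core) is written in a basis `(u, u′, ℓ)` of `V′_w` with Gram `[[0,1,0],[1,0,0],[0,0,d]]`
(`G(x) = Aσ(B)ᵀ + Bσ(A)ᵀ + d·Cσ(C)ᵀ`).  At an inert UNRAMIFIED place such a basis exists for EVERY non-degenerate diagonal ternary form: two of the three `d_k` have valuations of the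
same parity, so `−d_j∕d_i` has even valuation and is a NORM `λσ(λ)` (★ `UnramifiedQuadraticNormSurjective`: `σ`-fixed units are norms; `ϖ` is `σ`-fixed) — the input `hλ` below — and
the unramified trace hits `1` (★ `HermitianFormsHensel.exists_add_map_eq_one_of_isUnit_sub`) — the input `ht₀`, which replaces the division by `2` of the textbook `u′ = w − ½h(w,w)u`
and makes the construction DYADIC-SAFE.  This file is the field algebra; the DVR inputs are discharged by the frame hand at `K = L_{w₀}` ((T3-frame-ii-b)∕(iii), K2Liu-p08 (g4)).
* `herm_apply_single_single` etc. — bookkeeping of `h` on `Pi.single`;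
* **`exists_hyperbolic_pair`** — `∃ u u′` in `span(e_i, e_j)` with `h(u,u) = h(u′,u′) = 0`, `h(u,u′) = h(u′,u) = 1`, `h(u, e_k) = h(u′, e_k) = 0 = h(e_k, u) = h(e_k, u′)` for `k ∉ {i, j}`,
  and INVERTIBLE coordinate matrix `u_i u′_j − u_j u′_i ≠ 0` (so `(u, u′, (e_k)_{k∉{i,j}})` is a basis); the witnesses are `u = λe_i + e_j`, `u′ = d_j⁻¹e_j − (d_j⁻¹t₀)u`.
[Scharlau1985HermitianForms, Ch. 7 §6 (hyperbolic planes in hermitian spaces)] [Jacobowitz1962, §4] [Shimura1997, §13.2].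
HONEST LABEL.  Count-neutral helper; `HC_CM` is proved only modulo the 7 printed citations (2 remaining named inputs: hLiu418 = `stmt-HodgeConjecture-24832`,
h413 = `stmt-HodgeConjecture-24833`) until rung 0 closes.

## References
* [Scharlau1985HermitianForms] W. Scharlau, *Quadratic and Hermitian Forms*, Grundlehren 270 (1985), Ch. 7 §6.
* [Jacobowitz1962] R. Jacobowitz, *Hermitian forms over local fields*, Amer. J. Math. 84 (1962), §4.
* [Shimura1997] G. Shimura, *Euler products and Eisenstein series*, CBMS 93 (1997), §13.2.
-/

set_option autoImplicit false
set_option linter.dupNamespace false -- the mandated namespace repeats `HodgeConjecture.HodgeConjecture`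

open Finset

namespace Summit.HodgeConjecture.HodgeConjecture.Cruxes.HLiu418.K2LiuHyperbolicPairOfIsotropicNorm

variable {K : Type*} [Field K] (σ : K →+* K) {κ : Type*} [Fintype κ] [DecidableEq κ] (d : κ → K)

/-! ## §1 The diagonal hermitian form on coordinate vectors -/

/-- `h(e_a x, y) = d_a · x · σ(y_a)`. [folklore] -/
theorem herm_single_left (a : κ) (x : K) (y : κ → K) : (∑ k, d k * (Pi.single a x : κ → K) k * σ (y k)) = d a * x * σ (y a) := by
  rw [Finset.sum_eq_single a (fun k _ hk => by rw [Pi.single_eq_of_ne hk, mul_zero, zero_mul]) (fun h => absurd (mem_univ a) h), Pi.single_eq_same]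

/-- `h(x, e_a y) = d_a · x_a · σ(y)`. [folklore] -/
theorem herm_single_right (a : κ) (x : κ → K) (y : K) : (∑ k, d k * x k * σ ((Pi.single a y : κ → K) k)) = d a * x a * σ y := by
  rw [Finset.sum_eq_single a (fun k _ hk => by rw [Pi.single_eq_of_ne hk, map_zero, mul_zero]) (fun h => absurd (mem_univ a) h), Pi.single_eq_same]

/-- `h` is additive and `σ`-sesquilinear: `h(x + x′, y)`, `h(x, y + y′)`, `h(c x, y) = c h(x,y)`, `h(x, c y) = σ(c) h(x, y)` — packaged as the expansion of
`h(p e_i + q e_j, p′ e_i + q′ e_j)` for `i ≠ j`: `= d_i p σ(p′) + d_j q σ(q′)`. [folklore] -/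
theorem herm_pair_pair {i j : κ} (hij : i ≠ j) (p q p' q' : K) :
    (∑ k, d k * ((Pi.single i p : κ → K) + (Pi.single j q : κ → K)) k * σ (((Pi.single i p' : κ → K) + (Pi.single j q' : κ → K)) k)) = d i * p * σ p' + d j * q * σ q' := by
  have e : ∀ k, d k * ((Pi.single i p : κ → K) + (Pi.single j q : κ → K)) k * σ (((Pi.single i p' : κ → K) + (Pi.single j q' : κ → K)) k) =
      d k * (Pi.single i p : κ → K) k * σ ((Pi.single i p' : κ → K) k) + d k * (Pi.single i p : κ → K) k * σ ((Pi.single j q' : κ → K) k) +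
        (d k * (Pi.single j q : κ → K) k * σ ((Pi.single i p' : κ → K) k) + d k * (Pi.single j q : κ → K) k * σ ((Pi.single j q' : κ → K) k)) := fun k => by
    simp only [Pi.add_apply, map_add]; ring
  simp only [e, sum_add_distrib, herm_single_left, Pi.single_eq_same, Pi.single_eq_of_ne hij, Pi.single_eq_of_ne (Ne.symm hij), map_zero, mul_zero, add_zero, zero_add]

/-- vectors in `span(e_i, e_j)` are `h`-orthogonal to `e_k`, `k ∉ {i, j}` (both orders). [folklore] -/
theorem herm_pair_single_eq_zero {i j k : κ} (hki : k ≠ i) (hkj : k ≠ j) (p q c : K) :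
    (∑ l, d l * ((Pi.single i p : κ → K) + (Pi.single j q : κ → K)) l * σ ((Pi.single k c : κ → K) l)) = 0 ∧ (∑ l, d l * (Pi.single k c : κ → K) l * σ (((Pi.single i p : κ → K) + (Pi.single j q : κ → K)) l)) = 0 := by
  refine ⟨?_, ?_⟩
  · rw [herm_single_right, Pi.add_apply, Pi.single_eq_of_ne hki, Pi.single_eq_of_ne hkj, add_zero, mul_zero, zero_mul]
  · rw [herm_single_left, Pi.add_apply, Pi.single_eq_of_ne hki, Pi.single_eq_of_ne hkj, add_zero, map_zero, mul_zero]

/-! ## §2 The hyperbolic pair -/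

/-- **THE HYPERBOLIC PAIR.**  For `i ≠ j`, `σ`-fixed `d_j ≠ 0`, an isotropic norm solution `d_i·(λσλ) + d_j = 0` and a trace-one element `t₀ + σ t₀ = 1` (no other hypothesis on `σ`):
there are `u, u′ ∈ span(e_i, e_j)` with `h(u,u) = h(u′,u′) = 0`, `h(u,u′) = h(u′,u) = 1`, orthogonal to every `e_k` (`k ∉ {i,j}`), with invertible coordinate matrix
(`u = λe_i + e_j`, `u′ = d_j⁻¹e_j − (d_j⁻¹t₀)·u`). [cite: Scharlau1985HermitianForms, Ch. 7 §6] [cite: Jacobowitz1962, §4] -/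
theorem exists_hyperbolic_pair {i j : κ} (hij : i ≠ j) (hdj : σ (d j) = d j) (hdj0 : d j ≠ 0)
    {lam : K} (hlam : d i * (lam * σ lam) + d j = 0) {t₀ : K} (ht₀ : t₀ + σ t₀ = 1) :
    ∃ p q p' q' : K,
      (∑ k, d k * ((Pi.single i p : κ → K) + (Pi.single j q : κ → K)) k * σ (((Pi.single i p : κ → K) + (Pi.single j q : κ → K)) k)) = 0 ∧
      (∑ k, d k * ((Pi.single i p' : κ → K) + (Pi.single j q' : κ → K)) k * σ (((Pi.single i p' : κ → K) + (Pi.single j q' : κ → K)) k)) = 0 ∧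
      (∑ k, d k * ((Pi.single i p : κ → K) + (Pi.single j q : κ → K)) k * σ (((Pi.single i p' : κ → K) + (Pi.single j q' : κ → K)) k)) = 1 ∧
      (∑ k, d k * ((Pi.single i p' : κ → K) + (Pi.single j q' : κ → K)) k * σ (((Pi.single i p : κ → K) + (Pi.single j q : κ → K)) k)) = 1 ∧
      p * q' - q * p' ≠ 0 := by
  -- `u = λ e_i + 1 e_j`, `u′ = −α λ e_i + (d_j⁻¹ − α) e_j`, `α = d_j⁻¹ t₀`
  have hlam0 : lam ≠ 0 := by
    rintro rfl
    rw [zero_mul, mul_zero, zero_add] at hlam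
    exact hdj0 hlam
  have hσdj : σ (d j)⁻¹ = (d j)⁻¹ := by rw [map_inv₀, hdj]
  refine ⟨lam, 1, -((d j)⁻¹ * t₀) * lam, (d j)⁻¹ - (d j)⁻¹ * t₀, ?_, ?_, ?_, ?_, ?_⟩
  · rw [herm_pair_pair σ d hij, map_one, mul_one, mul_one, mul_assoc]
    exact hlam
  · rw [herm_pair_pair σ d hij]
    have hst : σ t₀ = 1 - t₀ := by rw [← ht₀]; ring
    simp only [map_mul, map_neg, map_sub, hσdj, hst]
    -- `d_i (αλ)σ(αλ) + d_j (d_j⁻¹ − α) σ(d_j⁻¹ − α)` with `d_i λσλ = −d_j`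
    have hlam' : d i * (lam * σ lam) = -d j := eq_neg_of_add_eq_zero_left hlam
    have e : d i * (-((d j)⁻¹ * t₀) * lam) * (-((d j)⁻¹ * (1 - t₀)) * σ lam) =
        ((d j)⁻¹ * t₀) * ((d j)⁻¹ * (1 - t₀)) * (d i * (lam * σ lam)) := by ring
    rw [e, hlam']
    field_simp
    ring
  · rw [herm_pair_pair σ d hij]
    simp only [map_mul, map_neg, map_sub, hσdj]
    have hlam' : d i * (lam * σ lam) = -d j := eq_neg_of_add_eq_zero_left hlam
    have e : d i * lam * (-((d j)⁻¹ * σ t₀) * σ lam) = -((d j)⁻¹ * σ t₀) * (d i * (lam * σ lam)) := by ring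
    rw [e, hlam']
    field_simp
    ring
  · rw [herm_pair_pair σ d hij]
    simp only [map_one, mul_one]
    have hlam' : d i * (lam * σ lam) = -d j := eq_neg_of_add_eq_zero_left hlam
    have e : d i * (-((d j)⁻¹ * t₀) * lam) * σ lam = -((d j)⁻¹ * t₀) * (d i * (lam * σ lam)) := by ring
    rw [e, hlam']
    field_simp
    ring
  · -- `λ (d_j⁻¹ − α) − 1·(−αλ) = λ d_j⁻¹ ≠ 0`
    have e : lam * ((d j)⁻¹ - (d j)⁻¹ * t₀) - 1 * (-((d j)⁻¹ * t₀) * lam) = lam * (d j)⁻¹ := by ring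
    rw [e]
    exact mul_ne_zero hlam0 (inv_ne_zero hdj0)

/-- **… AND ORTHOGONAL TO THE REMAINING FRAME VECTORS**: for `k ∉ {i, j}` every vector of `span(e_i, e_j)` is `h`-orthogonal to `e_k` on both sides, and `h(e_k, e_k) = d_k`
(so `ℓ := e_k` completes `(u, u′)` to a basis with Gram `[[0,1,0],[1,0,0],[0,0,d_k]]` in rank three). [cite: Scharlau1985HermitianForms, Ch. 7 §6] -/
theorem herm_single_single_self (k : κ) : (∑ l, d l * (Pi.single k (1 : K) : κ → K) l * σ ((Pi.single k (1 : K) : κ → K) l)) = d k := by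
  rw [herm_single_left, Pi.single_eq_same, map_one, mul_one, mul_one]

/-- parity pigeonhole: among three integers two have the same parity (choice of the pair `(i, j)` with `v(d_i) ≡ v(d_j) (2)`). [folklore] -/
theorem exists_pair_even_sub (v : Fin 3 → ℤ) : ∃ i j : Fin 3, i ≠ j ∧ Even (v i - v j) := by
  rcases Int.even_or_odd (v 0) with h0 | h0 <;> rcases Int.even_or_odd (v 1) with h1 | h1
  · exact ⟨0, 1, by decide, h0.sub h1⟩
  · rcases Int.even_or_odd (v 2) with h2 | h2
    · exact ⟨0, 2, by decide, h0.sub h2⟩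
    · exact ⟨1, 2, by decide, h1.sub_odd h2⟩
  · rcases Int.even_or_odd (v 2) with h2 | h2
    · exact ⟨1, 2, by decide, h1.sub h2⟩
    · exact ⟨0, 2, by decide, h0.sub_odd h2⟩
  · exact ⟨0, 1, by decide, h0.sub_odd h1⟩

end Summit.HodgeConjecture.HodgeConjecture.Cruxes.HLiu418.K2LiuHyperbolicPairOfIsotropicNorm
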